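import Literature.Probability.LatticeModels.WallLimitState
import Literature.Probability.LatticeModels.StripWetting
import Literature.Probability.LatticeModels.PlusSeaLemma
import Literature.Probability.LatticeModels.AizenmanHiguchiFromInvariance
import Literature.Probability.LatticeModels.IsingGibbsMixture
import Literature.Probability.LatticeModels.IsingGibbsFlip
import HarnessLib

/-!
# No percolation in the bordered half-plane (Georgii–Higuchi 2000, Lemma 4.2)

Topic `Probability/LatticeModels`. Georgii–Higuchi, J. Math. Phys. 41 (2000), Lemma 4.2: for
`β > β_c` on `ℤ²`, `μ^±_up(E^{+∗}_up) = 0` — in the semi-infinite state above a `-` wall there is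
almost surely no infinite `+∗`cluster in the upper half-plane ("the minus spins percolate; no
`+∗` percolation", complete wetting by the minus phase). GH's proof: `μ^±_up ≼ μ⁺_-`, the
increasing translation invariant limit `μ⁺_- = lim μ⁺_{n,-} = a μ⁻ + (1-a) μ⁺` (Cor. 3.2), and
`a ≥ θ/2 > 0` by Lemma 2.3, so `μ^±_up(E^{+∗}_up) ≤ 1 - a < 1`, whence `= 0` by the tail
triviality of `μ^±_up`. We follow this with two changes: the mixture representation is Lebowitz's
(`translationInvariant_eq_mixture_two`, the tree's route through BGJS), and **`a ≥ 1/2`** comes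
from the strip argument `μ^±_0(σ_{(0,n)}) ≤ 0` (`StripWetting`) instead of Lemma 2.3:
`μ⁺_-(σ_0) = lim μ^±_0(σ_{(0,n)}) ≤ 0` while `μ⁺_-(σ_0) = (1-2a) m*(β)` with `m*(β) > 0`.

Contents:
* `isTailTrivial_upperPMState` — `μ^±_0` is trivial on the tail σ-field (maximality among the
  measures satisfying the DLR equations in the half-plane and dominated by `μ^±_0`; the argument of
  the tree's `eq_smul_of_dlr_of_le_plus`, GH: "it follows just as for `μ⁺` that `μ^±_up` is trivial
  on `𝒯_up`");
* `measure_upperPMState_le_wallLimitState` — `μ^±_0(A) ≤ μ⁺_-(A)` for increasing local events, and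
  `upperPMState_infCluster_le` — for the (non-local) events "some site of `Λ_m` has an infinite
  `+∗`cluster in the half-plane", by local approximation;
* `wallLimitState_weight_le_half` — the mixture `μ⁺_- = t μ⁺ + (1-t) μ⁻` has `t ≤ 1/2`;
* **`upperPMState_existsInfClusterIn_star_eq_zero`** — Lemma 4.2.

## References

* H.-O. Georgii, Y. Higuchi, J. Math. Phys. 41 (2000), Lemma 4.2 (p. 10), §4 eq. (2)
  [GeorgiiHiguchi2000].
* S. Friedli, Y. Velenik, *Statistical Mechanics of Lattice Systems* (CUP 2017), Thm. 6.63,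
  Lemma 6.65 [FriedliVelenik2017].
-/

noncomputable section

open MeasureTheory Filter Topology Finset
open Literature.Probability.Percolation
open scoped ENNReal

namespace Literature.Probability.LatticeModels

variable {β : ℝ}

/-! ### Tail triviality of the semi-infinite state -/

section Tail

/-- `μ^±_n`-almost surely the configuration lies below `η^±_n`. [cite: GeorgiiHiguchi2000, §4 eq. (2)] -/
theorem ae_le_pmBC_upperPMState (hβ : 0 ≤ β) (n : ℤ) : ∀ᵐ σ ∂(upperPMState hβ n), σ ≤ pmBC n := by
  have h : ∀ x : Site 2, ∀ᵐ σ ∂(upperPMState hβ n), σ x ≤ pmBC n x := by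
    intro x
    by_cases hx : n ≤ x 1
    · exact Eventually.of_forall fun σ => by rw [pmBC_of_le hx]; exact intUnits_le_one _
    · have h1 := upperPMState_apply_eq_neg_one hβ (not_le.1 hx)
      have hm : MeasurableSet {σ : SpinConfig (Site 2) | σ x = -1} :=
        measurableSet_eq_fun (measurable_pi_apply x) measurable_const
      have h2 : ∀ᵐ σ ∂(upperPMState hβ n), σ x = -1 := by
        rw [ae_iff]
        have := (prob_compl_eq_zero_iff hm).2 h1
        simpa [Set.compl_setOf] using this
      filter_upwards [h2] with σ hσ
      rw [hσ]; exact neg_one_le_intUnits _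
  rw [← ae_all_iff] at h
  filter_upwards [h] with σ hσ x using hσ x

/-- **DLR with a frozen outside event, region form**: for `μ` Gibbs in `W`, `Λ ⊆ W` and
`B ∈ 𝓕_{Λᶜ}`, `∫ γ_Λ(A | η) μ|_B(dη) = μ|_B(A)`. [cite: Georgii2011, Def. 1.23 / Rem. 1.24] -/
theorem IsGibbsIn.lintegral_spec_restrict {V S : Type*} [MeasurableSpace S] {γ : Specification V S}
    (hγ : IsSpecification γ) {W : Set V} {μ : Measure (V → S)} (hμ : IsGibbsIn W γ μ)
    (Λ : Finset V) (hΛ : (↑Λ : Set V) ⊆ W) {B : Set (V → S)}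
    (hB : MeasurableSet[cylinderEvents (X := fun _ : V => S) ((↑Λ : Set V)ᶜ)] B)
    {A : Set (V → S)} (hA : MeasurableSet A) :
    ∫⁻ η, γ Λ η A ∂(μ.restrict B) = (μ.restrict B) A := by
  have hBm : MeasurableSet B := cylinderEvents_le_pi _ hB
  rw [Measure.restrict_apply hA, ← hμ.2 Λ hΛ (A ∩ B) (hA.inter hBm), ← lintegral_indicator hBm]
  refine lintegral_congr fun η => ?_
  rw [hγ.measure_inter_of_cylinderEvents Λ A hB η]
  by_cases hη : η ∈ B
  · simp [Set.indicator_of_mem hη]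
  · simp [Set.indicator_of_notMem hη]

/-- **`μ^±_0` is trivial on the tail σ-field** (Georgii–Higuchi 2000, §4: "it follows just as for
`μ⁺` that `μ^±_up` is trivial on `𝒯_up`"). For a tail event `B`, `κ = μ|_B` satisfies the DLR
equations for the volumes `Δ_L ⊆ π_0` and `κ ≤ μ`; on `E = {σ_S ≡ +1}`,
`κ(E) = ∫ μ^η_{Δ_L}(E) dκ ≤ κ(Ω) μ^{η±}_{Δ_L}(E)` (boundary monotonicity, `η ≤ η±` a.s.) and
`μ(E) - κ(E) ≤ (1 - κ(Ω)) μ^{η±}_{Δ_L}(E)`; as `L → ∞`, `μ^{η±}_{Δ_L}(E) → μ(E)`, so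
`κ = κ(Ω) μ` and `μ(B) μ(Bᶜ) = 0`. [cite: GeorgiiHiguchi2000, Lemma 4.2 (proof)] -/
theorem isTailTrivial_upperPMState (hβ : 0 ≤ β) : IsTailTrivial (upperPMState hβ 0) := by
  classical
  set μ := upperPMState hβ 0 with hμdef
  have hγ : IsSpecification (isingSpecification (zdGraph 2) β 0) :=
    isSpecification_isingSpecification_zd_holds 2 β 0
  have hG := isGibbsIn_upperPMState hβ 0
  intro B hB
  have hBm : MeasurableSet B := MeasurableSet.of_tailEvents hB
  set κ := μ.restrict B with hκdef
  have hle : κ ≤ μ := Measure.restrict_le_self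
  haveI : IsFiniteMeasure κ := inferInstance
  -- DLR for `κ` in the half-plane volumes
  have hκ : ∀ (L : ℕ) (A : Set (SpinConfig (Site 2))), MeasurableSet A →
      ∫⁻ η, isingSpecification (zdGraph 2) β 0 (halfBox 0 L) η A ∂κ = κ A := fun L A hA =>
    IsGibbsIn.lintegral_spec_restrict hγ hG (halfBox 0 L) (coe_halfBox_subset_halfPlane 0 L)
      (tailEvents_le_cylinderEvents _ _ hB) hA
  have hael : ∀ᵐ σ ∂μ, σ ≤ pmBC 0 := ae_le_pmBC_upperPMState hβ 0
  have key : ∀ S : Finset (Site 2), κ.real {σ : SpinConfig (Site 2) | ∀ i ∈ S, σ i = 1} =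
      κ.real Set.univ * μ.real {σ : SpinConfig (Site 2) | ∀ i ∈ S, σ i = 1} := by
    intro S
    set E : Set (SpinConfig (Site 2)) := {σ | ∀ i ∈ S, σ i = 1} with hEdef
    have hE : MeasurableSet E := measurableSet_forall_eq_one S
    set c : ℝ := κ.real Set.univ with hcdef
    set F : ℕ → SpinConfig (Site 2) → ℝ := fun L η =>
      (isingMeasure (zdGraph 2) (halfBox 0 L) β 0 (.fixed η)).real E with hFdef
    set M : ℕ → ℝ := fun L => (halfBoxMeasure β 0 L).real E with hMdef
    -- `F_L η ≤ M_L` for `η ≤ η±`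
    have hFM : ∀ L η, η ≤ pmBC 0 → F L η ≤ M L := by
      intro L η hη
      simp only [hFdef, hMdef, halfBoxMeasure, hEdef]
      rw [measureReal_forall_eq_one_eq_integral_plusIndicator, measureReal_forall_eq_one_eq_integral_plusIndicator]
      exact isingExpect_fixed_mono (zdGraph 2) hβ _ 0 hη (plusIndicator_mono S) (measurable_plusIndicator S)
    have hFm : ∀ L, Measurable (F L) := fun L => (hγ.measurable_coe (halfBox 0 L) hE).ennreal_toReal
    have hF0 : ∀ L η, 0 ≤ F L η := fun L η => measureReal_nonneg
    have hF1 : ∀ L η, F L η ≤ 1 := fun L η => measureReal_le_one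
    have hFi : ∀ (ν : Measure (SpinConfig (Site 2))) [IsFiniteMeasure ν] (L : ℕ), Integrable (F L) ν :=
      fun ν _ L => Integrable.of_bound (hFm L).aestronglyMeasurable 1 (Eventually.of_forall fun η => by
        rw [Real.norm_eq_abs, abs_of_nonneg (hF0 L η)]; exact hF1 L η)
    -- DLR in real form
    have hdlr : ∀ (ν : Measure (SpinConfig (Site 2))) [IsFiniteMeasure ν] (L : ℕ),
        (∫⁻ η, isingSpecification (zdGraph 2) β 0 (halfBox 0 L) η E ∂ν = ν E) → ν.real E = ∫ η, F L η ∂ν := by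
      intro ν _ L hν
      have hm : Measurable fun η : SpinConfig (Site 2) => isingMeasure (zdGraph 2) (halfBox 0 L) β 0 (.fixed η) E :=
        hγ.measurable_coe (halfBox 0 L) hE
      simp_rw [hFdef, measureReal_def]
      rw [← hν, integral_toReal hm.aemeasurable (Eventually.of_forall fun η => measure_lt_top _ _)]
      rfl
    have hκF : ∀ L, κ.real E = ∫ η, F L η ∂κ := fun L => hdlr κ L (hκ L E hE)
    have hμF : ∀ L, μ.real E = ∫ η, F L η ∂μ := fun L =>
      hdlr μ L (hG.2 (halfBox 0 L) (coe_halfBox_subset_halfPlane 0 L) E hE)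
    -- (b) `κ(E) ≤ κ(Ω) M_L`
    have hb : ∀ L, κ.real E ≤ c * M L := fun L => by
      rw [hκF L]
      calc ∫ η, F L η ∂κ ≤ ∫ _, M L ∂κ :=
            integral_mono_ae (hFi κ L) (integrable_const _)
              (ae_restrict_of_ae (hael.mono fun η hη => hFM L η hη))
        _ = c * M L := by rw [integral_const, smul_eq_mul]
    -- (c) `κ(Ω) M_L - κ(E) ≤ M_L - μ(E)`
    have hc : ∀ L, c * M L - κ.real E ≤ M L - μ.real E := fun L => by
      have h1 : ∫ η, (M L - F L η) ∂κ ≤ ∫ η, (M L - F L η) ∂μ :=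
        integral_mono_measure hle (hael.mono fun η hη => sub_nonneg.2 (hFM L η hη))
          ((integrable_const _).sub (hFi μ L))
      rw [integral_sub (integrable_const _) (hFi κ L), integral_sub (integrable_const _) (hFi μ L),
        integral_const, integral_const, smul_eq_mul, smul_eq_mul, ← hκF L, ← hμF L] at h1
      simp only [probReal_univ, one_mul] at h1
      exact h1
    -- `L → ∞`: `M_L → μ(E)`
    have hlim : Tendsto M atTop (𝓝 (μ.real E)) := by
      have := tendsto_integral_upperPMState hβ 0 (dependsOn_plusIndicator' S)
      simp_rw [← measureReal_forall_eq_one_eq_integral_plusIndicator] at this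
      exact this
    have hup : κ.real E ≤ c * μ.real E := ge_of_tendsto' (hlim.const_mul c) hb
    have hdown : c * μ.real E - κ.real E ≤ μ.real E - μ.real E :=
      le_of_tendsto_of_tendsto' ((hlim.const_mul c).sub_const _) (hlim.sub_const _) hc
    linarith
  have hκeq : κ = κ Set.univ • μ := by
    refine ext_of_generate_finite _ generateFrom_range_forall_eq_one isPiSystem_range_forall_eq_one ?_ ?_
    · rintro _ ⟨S, rfl⟩
      dsimp only
      rw [Measure.smul_apply, smul_eq_mul, ← ofReal_measureReal (measure_ne_top κ _), key S,
        ENNReal.ofReal_mul measureReal_nonneg, ofReal_measureReal (measure_ne_top κ _),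
        ofReal_measureReal (measure_ne_top μ _)]
    · rw [Measure.smul_apply, smul_eq_mul, show μ Set.univ = 1 from measure_univ, mul_one]
  have h0 : κ Bᶜ = κ Set.univ * μ Bᶜ := by
    conv_lhs => rw [hκeq]
    rw [Measure.smul_apply, smul_eq_mul]
  rw [hκdef, Measure.restrict_apply hBm.compl, Set.compl_inter_self, measure_empty,
    Measure.restrict_apply MeasurableSet.univ, Set.univ_inter] at h0
  rcases mul_eq_zero.1 h0.symm with h1 | h1
  · exact Or.inl h1
  · exact Or.inr ((prob_compl_eq_zero_iff hBm).1 h1)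

end Tail

/-! ### Domination `μ^±_0 ≼ μ⁺_-` on increasing events -/

section Domination

/-- **`μ^±_0(A) ≤ μ⁺_-(A)` for increasing local events.** [cite: GeorgiiHiguchi2000, Lemma 4.2 (proof)] -/
theorem measure_upperPMState_le_wallLimitState (hβ : 0 ≤ β) {A : Set (SpinConfig (Site 2))}
    (hAm : MeasurableSet A) (hAup : IsUpperSet A) {D : Finset (Site 2)}
    (hAloc : ∀ σ τ : SpinConfig (Site 2), (∀ x ∈ D, σ x = τ x) → (σ ∈ A ↔ τ ∈ A)) :
    upperPMState hβ 0 A ≤ wallLimitState hβ A := by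
  have hdep : DependsOn (A.indicator (1 : SpinConfig (Site 2) → ℝ)) (↑D : Set (Site 2)) := by
    intro σ τ h
    have := hAloc σ τ fun x hx => h x hx
    by_cases hσ : σ ∈ A
    · simp only [Set.indicator_of_mem hσ, Set.indicator_of_mem (this.1 hσ), Pi.one_apply]
    · rw [Set.indicator_of_notMem hσ, Set.indicator_of_notMem (fun h' => hσ (this.2 h'))]
  have hmono : Monotone (A.indicator (1 : SpinConfig (Site 2) → ℝ)) := by
    intro σ τ hστ
    by_cases hσ : σ ∈ A
    · simp only [Set.indicator_of_mem hσ, Set.indicator_of_mem (hAup hστ hσ), Pi.one_apply, le_refl]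
    · rw [Set.indicator_of_notMem hσ]
      exact Set.indicator_nonneg (fun _ _ => zero_le_one) _
  have hbd : ∀ σ, |A.indicator (1 : SpinConfig (Site 2) → ℝ) σ| ≤ 1 := fun σ => by
    by_cases hσ : σ ∈ A
    · rw [Set.indicator_of_mem hσ]; simp
    · rw [Set.indicator_of_notMem hσ]; simp
  have h := integral_upperPMState_le_wallLimitState hβ hdep hmono (measurable_one.indicator hAm) hbd 0
  simp only [Nat.cast_zero, neg_zero, integral_indicator_one hAm] at h
  exact (ENNReal.toReal_le_toReal (measure_ne_top _ _) (measure_ne_top _ _)).1 h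

/-- The local increasing events "some site of `Λ_m` is joined inside `Λ_{N+1}` by `+` sites of the
half-plane to a site outside `Λ_N`" (`∗`-connections). [cite: GeorgiiHiguchi2000, Lemma 4.2 (proof)] -/
def reachOut (m N : ℕ) : Set (SpinConfig (Site 2)) :=
  {ω | ∃ x ∈ box 2 m, ∃ b ∉ box 2 N,
    (siteOpenGraph zdStarGraph (spinSites 1 ω ∩ halfPlane 0 ∩ ↑(box 2 (N + 1)))).Reachable x b}

/-- `reachOut m N` is determined by the spins in `Λ_{N+1}`. [folklore] -/
theorem reachOut_local (m N : ℕ) : ∀ ω ω' : SpinConfig (Site 2), (∀ z ∈ box 2 (N + 1), ω z = ω' z) →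
    (ω ∈ reachOut m N ↔ ω' ∈ reachOut m N) := by
  intro ω ω' h
  have hO : spinSites 1 ω ∩ halfPlane 0 ∩ ↑(box 2 (N + 1)) = spinSites 1 ω' ∩ halfPlane 0 ∩ ↑(box 2 (N + 1)) := by
    ext z
    simp only [Set.mem_inter_iff, mem_spinSites, Finset.mem_coe]
    constructor
    · rintro ⟨⟨hz, hzP⟩, hzB⟩; exact ⟨⟨by rw [← h z hzB]; exact hz, hzP⟩, hzB⟩
    · rintro ⟨⟨hz, hzP⟩, hzB⟩; exact ⟨⟨by rw [h z hzB]; exact hz, hzP⟩, hzB⟩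
  simp only [reachOut, Set.mem_setOf_eq, hO]

/-- `reachOut` is measurable. [folklore] -/
theorem measurableSet_reachOut (m N : ℕ) : MeasurableSet (reachOut m N) :=
  cylinderEvents_le_pi _ (measurableSet_cylinderEvents_of_forall_eq (K := box 2 (N + 1)) (reachOut_local m N))

/-- `reachOut` is increasing. [folklore] -/
theorem isUpperSet_reachOut (m N : ℕ) : IsUpperSet (reachOut m N) := by
  intro ω ω' hle hω
  obtain ⟨x, hx, b, hb, hr⟩ := hω
  refine ⟨x, hx, b, hb, hr.mono (siteOpenGraph_mono _ ?_)⟩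
  exact Set.inter_subset_inter_left _ (Set.inter_subset_inter_left _ (spinSites_one_mono hle))

/-- An infinite `+∗`cluster of the half-plane through `Λ_m` reaches out of every `Λ_N`, `N ≥ m`,
inside `Λ_{N+1}` (first exit). [folklore] -/
theorem infinite_cluster_subset_reachOut {m N : ℕ} (hmN : m ≤ N) :
    {ω : SpinConfig (Site 2) | ∃ x ∈ box 2 m,
      (siteCluster zdStarGraph (spinSites 1 ω ∩ halfPlane 0) x).Infinite} ⊆ reachOut m N := by
  rintro ω ⟨x, hx, hinf⟩
  have hxN : x ∈ box 2 N := box_mono 2 hmN hx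
  obtain ⟨y, hy, hyN⟩ : ∃ y ∈ siteCluster zdStarGraph (spinSites 1 ω ∩ halfPlane 0) x, y ∉ box 2 N := by
    by_contra h
    push Not at h
    exact hinf ((box 2 N).finite_toSet.subset fun y hy => h y hy)
  obtain ⟨-, -, hr⟩ := hy
  obtain ⟨p⟩ := hr
  obtain ⟨a, b, ha, hb, hab, -, hreach⟩ := exists_adj_reachable_withinGraph_of_walk
    (siteOpenGraph zdStarGraph (spinSites 1 ω ∩ halfPlane 0)) p (S := (↑(box 2 N) : Set (Site 2))) hxN
    ⟨y, SimpleGraph.Walk.end_mem_support p, hyN⟩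
  have hab' := (siteOpenGraph_adj _ _ _ _).1 hab
  refine ⟨x, hx, b, hb, ?_⟩
  -- `x → a` inside `Λ_N`, then the edge `a b` inside `Λ_{N+1}`
  have hbN1 : b ∈ box 2 (N + 1) := by
    have ha := Finset.mem_coe.1 ha
    rw [mem_box] at ha ⊢
    intro i
    have h1 := hab'.1.2 i
    have h2 := ha i
    rw [abs_le] at h1
    push_cast
    constructor <;> linarith [h1.1, h1.2, h2.1, h2.2]
  have hO : spinSites 1 ω ∩ halfPlane 0 ∩ ↑(box 2 N) ⊆ spinSites 1 ω ∩ halfPlane 0 ∩ ↑(box 2 (N + 1)) :=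
    Set.inter_subset_inter_right _ (Finset.coe_subset.2 (box_mono 2 (Nat.le_succ N)))
  rw [withinGraph_siteOpenGraph] at hreach
  refine (hreach.mono (siteOpenGraph_mono _ hO)).trans (SimpleGraph.Adj.reachable ?_)
  rw [siteOpenGraph_adj]
  exact ⟨hab'.1, ⟨hab'.2.1, Finset.mem_coe.2 (box_mono 2 (Nat.le_succ N) (Finset.mem_coe.1 ha))⟩,
    ⟨hab'.2.2, Finset.mem_coe.2 hbN1⟩⟩

/-- Conversely, reaching out of every box from `Λ_m` forces an infinite `+∗`cluster through `Λ_m`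
(pigeonhole over the finitely many starting sites). [folklore] -/
theorem iInter_reachOut_subset (m : ℕ) :
    (⋂ N ∈ Set.Ici m, reachOut m N) ⊆ {ω : SpinConfig (Site 2) | ∃ x ∈ box 2 m,
      (siteCluster zdStarGraph (spinSites 1 ω) x).Infinite} := by
  intro ω hω
  have hall : ∀ N, m ≤ N → ∃ x ∈ box 2 m, ∃ b ∉ box 2 N, b ∈ siteCluster zdStarGraph (spinSites 1 ω) x := by
    intro N hN
    obtain ⟨x, hx, b, hb, hr⟩ := Set.mem_iInter₂.1 hω N hN
    refine ⟨x, hx, b, hb, ?_⟩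
    have hr' : (siteOpenGraph zdStarGraph (spinSites 1 ω)).Reachable x b :=
      hr.mono (siteOpenGraph_mono _ (Set.inter_subset_left.trans Set.inter_subset_left))
    obtain ⟨p⟩ := hr
    have hxO : x ∈ spinSites 1 ω ∩ halfPlane 0 ∩ ↑(box 2 (N + 1)) := by
      -- the start of a nontrivial open walk is open: `b ≠ x` since `x ∈ Λ_N ∌ b`
      cases p with
      | nil => exact absurd (box_mono 2 hN hx) hb
      | cons hadj _ => exact ((siteOpenGraph_adj _ _ _ _).1 hadj).2.1
    exact ⟨hxO.1.1, (support_subset_of_walk_siteOpenGraph p hxO b (SimpleGraph.Walk.end_mem_support p)).1.1, hr'⟩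
  by_contra hfin
  simp only [Set.mem_setOf_eq, not_exists, not_and, Set.not_infinite] at hfin
  -- each of the finitely many clusters is eventually inside the boxes
  have hev : ∀ x ∈ box 2 m, ∀ᶠ N : ℕ in atTop, siteCluster zdStarGraph (spinSites 1 ω) x ⊆ ↑(box 2 N) := by
    intro x hx
    obtain ⟨N₀, hN₀⟩ := exists_forall_subset_box 2 (hfin x hx).toFinset
    refine eventually_atTop.2 ⟨N₀, fun N hN y hy => Finset.mem_coe.2 (hN₀ N hN ?_)⟩
    exact (hfin x hx).mem_toFinset.2 hy
  rw [← eventually_all_finset] at hev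
  obtain ⟨N, hN⟩ := (hev.and (eventually_ge_atTop m)).exists
  obtain ⟨x, hx, b, hb, hbC⟩ := hall N hN.2
  exact hb (Finset.mem_coe.1 (hN.1 x hx hbC))

/-- **`μ^±_0`(some site of `Λ_m` has an infinite `+∗`cluster in the half-plane)
`≤ μ⁺_-(E^{+∗})`.** [cite: GeorgiiHiguchi2000, Lemma 4.2 (proof)] -/
theorem upperPMState_infCluster_le (hβ : 0 ≤ β) (m : ℕ) :
    upperPMState hβ 0 {ω | ∃ x ∈ box 2 m, (siteCluster zdStarGraph (spinSites 1 ω ∩ halfPlane 0) x).Infinite} ≤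
      wallLimitState hβ (existsInfCluster zdStarGraph 1) := by
  set μ := upperPMState hβ 0
  set μw := wallLimitState hβ
  -- finite intersections of the local approximants
  set A : ℕ → Set (SpinConfig (Site 2)) := fun K => ⋂ N ∈ Finset.Icc m K, reachOut m N with hA
  have hAm : ∀ K, MeasurableSet (A K) := fun K =>
    Finset.measurableSet_biInter _ fun N _ => measurableSet_reachOut m N
  have hAanti : Antitone A := by
    intro K K' hKK' ω hω
    simp only [hA, Set.mem_iInter] at hω ⊢
    exact fun N hN => hω N (Finset.mem_Icc.2 ⟨(Finset.mem_Icc.1 hN).1, (Finset.mem_Icc.1 hN).2.trans hKK'⟩)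
  have h1 : ∀ K, μ {ω | ∃ x ∈ box 2 m, (siteCluster zdStarGraph (spinSites 1 ω ∩ halfPlane 0) x).Infinite} ≤ μw (A K) := by
    intro K
    refine (measure_mono fun ω hω => ?_).trans (measure_upperPMState_le_wallLimitState hβ (hAm K) ?_
      (D := box 2 (K + 1)) ?_)
    · exact Set.mem_iInter₂.2 fun N hN => infinite_cluster_subset_reachOut (Finset.mem_Icc.1 hN).1 hω
    · exact isUpperSet_iInter₂ fun N _ => isUpperSet_reachOut m N
    · intro σ τ hst
      simp only [hA, Set.mem_iInter]
      refine forall₂_congr fun N hN => reachOut_local m N σ τ fun z hz => hst z ?_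
      exact box_mono 2 (by have := (Finset.mem_Icc.1 hN).2; omega) hz
  have h2 : Tendsto (fun K => μw (A K)) atTop (𝓝 (μw (⋂ K, A K))) :=
    tendsto_measure_iInter_atTop (fun K => (hAm K).nullMeasurableSet) hAanti ⟨0, measure_ne_top _ _⟩
  have h3 : (⋂ K, A K) ⊆ existsInfCluster zdStarGraph 1 := by
    intro ω hω
    have hω' : ω ∈ ⋂ N ∈ Set.Ici m, reachOut m N := by
      refine Set.mem_iInter₂.2 fun N hN => ?_
      have := Set.mem_iInter.1 hω N
      simp only [hA, Set.mem_iInter] at this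
      exact this N (Finset.mem_Icc.2 ⟨hN, le_rfl⟩)
    obtain ⟨x, -, hx⟩ := iInter_reachOut_subset m hω'
    exact (mem_existsInfCluster_iff (G := zdStarGraph) (s := 1) (ω := ω)).2 ⟨x, hx⟩
  exact ge_of_tendsto' h2 h1 |>.trans (measure_mono h3)

end Domination

/-! ### The weight of the plus phase in `μ⁺_-` -/

section Weight

/-- `∫ σ_0 dμ⁺_- ≤ 0` (from `μ⁺_{n,-}(σ_0) = μ^±_0(σ_{(0,n)}) ≤ 0`). [cite: GeorgiiHiguchi2000, Lemma 4.2 (proof)] -/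
theorem integral_spinAt_zero_wallLimitState_le_zero (hβ : 0 ≤ β) :
    ∫ σ, spinAt 0 σ ∂(wallLimitState hβ) ≤ 0 := by
  have hdep : DependsOn (spinAt (V := Site 2) 0) (↑({0} : Finset (Site 2)) : Set (Site 2)) := by
    intro σ τ h; simp only [spinAt, h 0 (by simp)]
  refine le_of_tendsto' (tendsto_integral_wallLimitState hβ hdep) fun n => ?_
  rw [integral_spinAt_zero_upperPMState_neg]
  exact integral_spinAt_vert_upperPMState_le_zero hβ n

/-- **The mixture `μ⁺_- = t μ⁺ + (1-t) μ⁻` has `t ≤ 1/2`.** [cite: GeorgiiHiguchi2000, Lemma 4.2 (proof)] -/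
theorem wallLimitState_weight_le_half (hβc : criticalBeta 2 < β) (hβ : 0 ≤ β)
    {μp μm : Measure (SpinConfig (Site 2))} (hμp : μp ∈ isingGibbsMeasures 2 β 0)
    (hμm : μm ∈ isingGibbsMeasures 2 β 0)
    (hp : ∀ A, spinCorr μp A = plusCorr 2 β 0 A) (hm : ∀ A, spinCorr μm A = minusCorr 2 β 0 A)
    {t : ℝ≥0∞} (ht : t ≤ 1) (hmix : wallLimitState hβ = t • μp + (1 - t) • μm) :
    t ≤ 2⁻¹ := by
  have hμpG : IsGibbsMeasure (isingSpecification (zdGraph 2) β 0) μp := hμp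
  have hμmG : IsGibbsMeasure (isingSpecification (zdGraph 2) β 0) μm := hμm
  haveI := hμpG.isProbabilityMeasure
  haveI := hμmG.isProbabilityMeasure
  have hms : 0 < plusCorr 2 β 0 {0} := by
    rw [← spontaneousMagnetization_eq_plusCorr]
    exact spontaneousMagnetization_pos_of_criticalBeta_lt_holds (d := 2) le_rfl hβc
  have hmneg : minusCorr 2 β 0 {0} = -plusCorr 2 β 0 {0} := by
    rw [minusCorr_eq_plusCorr_neg hβ 0 {0}, neg_zero, Finset.card_singleton, pow_one]; ring
  have hint : ∀ (ν : Measure (SpinConfig (Site 2))) [IsFiniteMeasure ν], Integrable (spinAt (V := Site 2) 0) ν :=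
    fun ν _ => Integrable.of_bound (measurable_spinAt 0).aestronglyMeasurable 1
      (Eventually.of_forall fun σ => by rw [Real.norm_eq_abs, abs_spinAt])
  have h0 := integral_spinAt_zero_wallLimitState_le_zero hβ
  have ht' : t ≠ ⊤ := ne_top_of_le_ne_top ENNReal.one_ne_top ht
  have h1t : (1 - t) ≠ ⊤ := ne_top_of_le_ne_top ENNReal.one_ne_top tsub_le_self
  rw [hmix, integral_add_measure ((hint μp).smul_measure ht') ((hint μm).smul_measure h1t),
    integral_smul_measure, integral_smul_measure] at h0
  have hp0 : ∫ σ, spinAt 0 σ ∂μp = plusCorr 2 β 0 {0} := by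
    rw [← hp {0}, spinCorr]; simp [spinProduct]
  have hm0 : ∫ σ, spinAt 0 σ ∂μm = -plusCorr 2 β 0 {0} := by
    rw [← hmneg, ← hm {0}, spinCorr]; simp [spinProduct]
  rw [hp0, hm0, ENNReal.toReal_sub_of_le ht ENNReal.one_ne_top, ENNReal.toReal_one] at h0
  simp only [smul_eq_mul] at h0
  have htr : t.toReal ≤ 2⁻¹ := by nlinarith
  have : t = ENNReal.ofReal t.toReal := (ENNReal.ofReal_toReal ht').symm
  rw [this]
  calc ENNReal.ofReal t.toReal ≤ ENNReal.ofReal 2⁻¹ := ENNReal.ofReal_le_ofReal htr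
    _ = 2⁻¹ := by rw [ENNReal.ofReal_inv_of_pos (by norm_num)]; simp

end Weight

/-! ### Lemma 4.2 -/

section Main

/-- The minus state has no infinite `+∗`cluster (the flip of the plus-sea lemma). [cite: GeorgiiHiguchi2000, Cor. 3.3] -/
theorem measure_existsInfCluster_star_one_eq_zero_of_spinCorr_eq_minusCorr (hβc : criticalBeta 2 < β)
    {μm : Measure (SpinConfig (Site 2))} (hμm : μm ∈ isingGibbsMeasures 2 β 0)
    (hm : ∀ A, spinCorr μm A = minusCorr 2 β 0 A) :
    μm (existsInfCluster zdStarGraph 1) = 0 := by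
  have hβ : 0 ≤ β := (criticalBeta_nonneg 2).trans hβc.le
  have hμmG : IsGibbsMeasure (isingSpecification (zdGraph 2) β 0) μm := hμm
  set μ' := μm.map fun σ : SpinConfig (Site 2) => -σ with hμ'def
  have hμ' : μ' ∈ isingGibbsMeasures 2 β 0 := isGibbsMeasure_map_neg (zdGraph 2) β hμmG
  have hp' : ∀ A, spinCorr μ' A = plusCorr 2 β 0 A := fun A => by
    rw [hμ'def, spinCorr_map_neg, hm A, minusCorr_eq_plusCorr_neg hβ 0 A, neg_zero, ← mul_assoc, ← mul_pow]
    norm_num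
  have h := measure_existsInfCluster_star_neg_eq_zero_of_spinCorr_eq_plusCorr hβc hμ' hp'
  have hE : existsInfCluster zdStarGraph (-1 : ℤˣ) = existsInfClusterIn zdStarGraph (-1) Set.univ := by
    ext ω; simp [mem_existsInfCluster_iff, existsInfClusterIn]
  have hE' : existsInfCluster zdStarGraph (1 : ℤˣ) = existsInfClusterIn zdStarGraph 1 Set.univ := by
    ext ω; simp [mem_existsInfCluster_iff, existsInfClusterIn]
  rw [hE, hμ'def, map_neg_existsInfClusterIn] at h
  rw [hE']
  simpa using h

/-- **Georgii–Higuchi 2000, Lemma 4.2 (No percolation in the bordered half-plane).** For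
`β > β_c(2)`, the semi-infinite limit state `μ^±_0` above a `-` wall gives probability `0` to the
existence of an infinite `∗`-cluster of `+`spins in the upper half-plane: `μ^±_up(E^{+∗}_up) = 0`.
Proof (module docstring): `μ^±_0(E) ≤ μ⁺_-(E^{+∗}) = t μ⁺(E^{+∗}) + (1-t) μ⁻(E^{+∗}) ≤ t ≤ 1/2`
and tail triviality. [cite: GeorgiiHiguchi2000, Lemma 4.2] -/
theorem upperPMState_existsInfClusterIn_star_eq_zero (hβc : criticalBeta 2 < β)
    (hβ : 0 ≤ β := (criticalBeta_nonneg 2).trans hβc.le) :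
    upperPMState hβ 0 (existsInfClusterIn zdStarGraph 1 (halfPlane 0)) = 0 := by
  set μ := upperPMState hβ 0 with hμdef
  set E := existsInfClusterIn zdStarGraph (1 : ℤˣ) (halfPlane 0) with hEdef
  -- the mixture representation of `μ⁺_-`
  obtain ⟨μp, μm, hμp, hμm, hp, hm, t, ht, hmix⟩ := translationInvariant_eq_mixture_two hβc
    (wallLimitState_mem_isingGibbsMeasures hβ) (isTranslationInvariantMeasure_wallLimitState hβ)
  have hμpG : IsGibbsMeasure (isingSpecification (zdGraph 2) β 0) μp := hμp
  haveI := hμpG.isProbabilityMeasure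
  have ht2 := wallLimitState_weight_le_half hβc hβ hμp hμm hp hm ht hmix
  -- `μ⁺_-(E^{+∗}) ≤ t`
  have hw : wallLimitState hβ (existsInfCluster zdStarGraph 1) ≤ t := by
    rw [hmix, Measure.add_apply, Measure.smul_apply, Measure.smul_apply,
      measure_existsInfCluster_star_one_eq_zero_of_spinCorr_eq_minusCorr hβc hμm hm, smul_zero, add_zero,
      smul_eq_mul]
    exact mul_le_of_le_one_right' prob_le_one
  -- `μ(E) ≤ μ⁺_-(E^{+∗})`: `E` is the increasing union over `m` of the events of `upperPMState_infCluster_le`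
  have hE : μ E ≤ wallLimitState hβ (existsInfCluster zdStarGraph 1) := by
    have hcov : E ⊆ ⋃ m : ℕ, {ω | ∃ x ∈ box 2 m, (siteCluster zdStarGraph (spinSites 1 ω ∩ halfPlane 0) x).Infinite} := by
      rintro ω ⟨x, hx⟩
      obtain ⟨m, hm⟩ := (eventually_subset_box_holds (d := 2) {x}).exists
      exact Set.mem_iUnion.2 ⟨m, x, hm (Finset.mem_singleton_self x), hx⟩
    have hmono : Monotone fun m : ℕ => {ω : SpinConfig (Site 2) | ∃ x ∈ box 2 m,
        (siteCluster zdStarGraph (spinSites 1 ω ∩ halfPlane 0) x).Infinite} :=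
      fun m m' hmm' ω ⟨x, hx, h⟩ => ⟨x, box_mono 2 hmm' hx, h⟩
    refine (measure_mono hcov).trans ?_
    rw [hmono.measure_iUnion]
    exact iSup_le fun m => upperPMState_infCluster_le hβ m
  -- tail triviality
  rcases isTailTrivial_upperPMState hβ E (measurableSet_tailEvents_existsInfClusterIn 1 _) with h0 | h1
  · exact h0
  · exfalso
    have : (1 : ℝ≥0∞) ≤ 2⁻¹ := by
      calc (1 : ℝ≥0∞) = μ E := h1.symm
        _ ≤ t := hE.trans hw
        _ ≤ 2⁻¹ := ht2
    exact absurd this (not_le.2 (by norm_num))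

end Main

end Literature.Probability.LatticeModels
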